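import Mathlib.RingTheory.Valuation.ValuationSubring
import Mathlib.RingTheory.Localization.AtPrime.Basic
import Mathlib.RingTheory.RegularLocalRing.Defs
import Mathlib.RingTheory.Adjoin.Basic
import HarnessLib

/-!
# Local blowing ups along a valuation (Novacoski–Spivakovsky; Cossart–Piltant §2.2)

Topic: `Literature/AlgebraicGeometry/Resolution`. The elementary algebra of *local blowing ups
with respect to a valuation*, the steps out of which local uniformization statements are built
(Zariski; Novacoski–Spivakovsky 2014, Def. 2.8: "take `aᵢ, bᵢ ∈ R` with `ν(bᵢ) ≤ ν(aᵢ)`, let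
`R' = R[a₁/b₁, …, a_r/b_r]`, `m' = m_ν ∩ R'`; the local blowing up is `R → R⁽¹⁾ := R'_{m'}`,
`R⁽¹⁾ = {x/y ∈ K | x ∈ R', y ∈ R' ∖ m'}`"; Def. 2.11: along an ideal `I = (u₀, …, u_q)` with
`ν(u₀)` minimal, `R' = R[u₁/u₀, …, u_q/u₀]`; Def. 2.20: `ν` *admits local uniformization* on
`R` if some finite sequence of local blowing ups `R → R⁽¹⁾ → ⋯ → R⁽ⁿ⁾` ends with `R⁽ⁿ⁾`
regular; Cossart–Piltant 2019, §2.2 and Thm. 1.5: "local (Hironaka-permissible) blowing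
ups … `(𝒳₀,x₀) ← (𝒳₁,x₁) ← ⋯ ← (𝒳_r,x_r)`, where `xᵢ` is the center of `μ`").

Everything happens inside a field `K` with a valuation ring `O ⊆ K` (the valuation `ν`, in
Mathlib's multiplicative notation `O.valuation`, so "`ν(b) ≤ ν(a)`" reads
`O.valuation a ≤ O.valuation b`), for subrings `B ⊆ O`:

* `subringCentre B O h` — the centre `𝔪_O ∩ B` of `O` on `B` (a prime ideal);
* `locAtCentre B O` — the local ring `B_{𝔪_O ∩ B}` realised inside `K` as the fractions `y/z`,
  `y, z ∈ B`, `ν(z) = 0`; it contains `B`, lies in `O`, is a local ring dominated by `O`, is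
  idempotent and monotone, and `IsLocalization.AtPrime (locAtCentre B O) (subringCentre B O h)`;
* `IsLocalBlowup O B B'` — `B'` is a local blowing up of `B` with respect to `O` (NSp Def. 2.8):
  `B' = locAtCentre (B[t]) O` for a finite `t ⊆ O`; `IsLocalBlowupAlong O B I B'` — the local
  blowing up along a finitely generated ideal `I` of `B` (NSp Def. 2.11, the chart of a generator
  of minimal value); towers `Relation.ReflTransGen (IsLocalBlowup O)`;
* PROVED: a local blowing up along an ideal is a local blowing up (`IsLocalBlowupAlong.isLocalBlowup`);
  local blowing ups compose (`IsLocalBlowup.trans`, NSp Lemma 2.9 in reverse) so that a tower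
  of local blowing ups is one local blowing up or trivial (`exists_eq_locAtCentre_of_reflTransGen`);
  hence **local uniformization by a tower of local blowing ups (NSp Def. 2.20) yields the
  finitely-generated-model form used throughout this topic** (`exists_fg_regular_of_tower`:
  a finite `t ⊆ O` with `B[t]` regular at the centre of `O`), and conversely a finitely
  generated `B ⊆ B[t] ⊆ O` regular at the centre IS a one-step tower
  (`tower_of_exists_fg_regular`): the two definitions of local uniformization agree
  (`lu_tower_iff_fg`).

## Sources

* J. Novacoski, M. Spivakovsky, *Reduction of local uniformization to the rank one case*,
  arXiv:1204.4751 (2012/2014), Defs. 2.8, 2.11, 2.20, Lemmas 2.5, 2.9 (pp. 4–8, 13).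
* V. Cossart, O. Piltant, J. Algebra 529 (2019) 268–535, §2.2 (local blowing ups) and Thm. 1.5.
* O. Zariski, P. Samuel, *Commutative Algebra II*, Ch. VI §17 (centre of a valuation).
-/

noncomputable section

namespace Literature.AlgebraicGeometry.Resolution

universe u

variable {K : Type u} [Field K]

/-! ## The centre of a valuation ring on a subring -/

/-- The **centre** `𝔪_O ∩ B` of the valuation ring `O` on a subring `B ⊆ O` of `K` — the
`Subring` counterpart of `centreIdeal` (`LocalUniformization.lean`, `Subalgebra` over a field)
and `centre` (`SmoothUniformization.lean`, `Subalgebra` over a ring); all three are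
`(maximalIdeal O).comap (Subring.inclusion h)` by `rfl` (`subringCentre_eq`).
[cite: NovacoskiSpivakovsky2014, Def. 2.8] -/
def subringCentre (B : Subring K) (O : ValuationSubring K) (h : B ≤ O.toSubring) : Ideal B :=
  (IsLocalRing.maximalIdeal O).comap (Subring.inclusion h)

/-- `subringCentre` is the raw `comap` form used by `CPLocalUniformization`,
`RelLocalUniformization`, `LocalUniformization3` (and, for `B = A.toSubring`, literally
`centreIdeal A O h` / `centre A O h`). [folklore] -/
theorem subringCentre_eq (B : Subring K) (O : ValuationSubring K) (h : B ≤ O.toSubring) :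
    subringCentre B O h = (IsLocalRing.maximalIdeal O).comap (Subring.inclusion h) :=
  rfl

/-- Membership in the centre: `x ∈ 𝔪_O ∩ B` iff `ν(x) > 0`, i.e. `O.valuation x < 1`. [folklore] -/
theorem mem_subringCentre_iff {B : Subring K} {O : ValuationSubring K} (h : B ≤ O.toSubring)
    (x : B) : x ∈ subringCentre B O h ↔ O.valuation (x : K) < 1 := by
  rw [subringCentre, Ideal.mem_comap, ValuationSubring.valuation_lt_one_iff]
  rfl

/-- The centre is a prime ideal. [folklore] -/
instance subringCentre.isPrime (B : Subring K) (O : ValuationSubring K)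
    (h : B ≤ O.toSubring) : (subringCentre B O h).IsPrime :=
  Ideal.comap_isPrime _ _

/-- An element of `B ⊆ O` off the centre has value `1` (is a unit of `O`). [folklore] -/
theorem valuation_eq_one_of_not_mem_subringCentre {B : Subring K} {O : ValuationSubring K}
    (h : B ≤ O.toSubring) {x : B} (hx : x ∉ subringCentre B O h) : O.valuation (x : K) = 1 := by
  rw [mem_subringCentre_iff] at hx
  exact le_antisymm ((O.valuation_le_one_iff _).mpr (h x.2)) (not_lt.mp hx)

/-! ## Localisation at the centre, inside `K` -/

/-- An element of value `1` is nonzero. [folklore] -/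
theorem ne_zero_of_valuation_eq_one {O : ValuationSubring K} {z : K} (hz : O.valuation z = 1) :
    z ≠ 0 := by
  rintro rfl
  simp at hz

/-- **`B_{𝔪_O ∩ B}` inside `K`**: the fractions `y / z` with `y, z ∈ B` and `ν(z) = 0`, i.e.
`O.valuation z = 1` (Novacoski–Spivakovsky, Def. 2.8 (1): `R'_{m'} = {x/y ∈ K | x ∈ R',
y ∈ R' ∖ m'}`). Defined for every subring `B`; it is the localisation at the centre when
`B ⊆ O`. [cite: NovacoskiSpivakovsky2014, Def. 2.8] -/
def locAtCentre (B : Subring K) (O : ValuationSubring K) : Subring K where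
  carrier := {x | ∃ y ∈ B, ∃ z ∈ B, O.valuation z = 1 ∧ x = y / z}
  zero_mem' := ⟨0, B.zero_mem, 1, B.one_mem, by simp, by simp⟩
  one_mem' := ⟨1, B.one_mem, 1, B.one_mem, by simp, by simp⟩
  add_mem' := by
    rintro _ _ ⟨y₁, hy₁, z₁, hz₁, hv₁, rfl⟩ ⟨y₂, hy₂, z₂, hz₂, hv₂, rfl⟩
    refine ⟨y₁ * z₂ + y₂ * z₁, B.add_mem (B.mul_mem hy₁ hz₂) (B.mul_mem hy₂ hz₁), z₁ * z₂,
      B.mul_mem hz₁ hz₂, by simp [hv₁, hv₂], ?_⟩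
    have := ne_zero_of_valuation_eq_one hv₁
    have := ne_zero_of_valuation_eq_one hv₂
    field_simp
  mul_mem' := by
    rintro _ _ ⟨y₁, hy₁, z₁, hz₁, hv₁, rfl⟩ ⟨y₂, hy₂, z₂, hz₂, hv₂, rfl⟩
    refine ⟨y₁ * y₂, B.mul_mem hy₁ hy₂, z₁ * z₂, B.mul_mem hz₁ hz₂, by simp [hv₁, hv₂], ?_⟩
    have := ne_zero_of_valuation_eq_one hv₁
    have := ne_zero_of_valuation_eq_one hv₂
    field_simp
  neg_mem' := by
    rintro _ ⟨y, hy, z, hz, hv, rfl⟩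
    exact ⟨-y, B.neg_mem hy, z, hz, hv, by ring⟩

/-- Membership in `locAtCentre B O` (definitional unfolding). [folklore] -/
theorem mem_locAtCentre_iff {B : Subring K} {O : ValuationSubring K} {x : K} :
    x ∈ locAtCentre B O ↔ ∃ y ∈ B, ∃ z ∈ B, O.valuation z = 1 ∧ x = y / z :=
  Iff.rfl

/-- `B ⊆ B_{𝔪_O ∩ B}`. [folklore] -/
theorem le_locAtCentre (B : Subring K) (O : ValuationSubring K) : B ≤ locAtCentre B O :=
  fun x hx => ⟨x, hx, 1, B.one_mem, by simp, by simp⟩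

/-- `B_{𝔪_O ∩ B} ⊆ O` when `B ⊆ O` (NSp Lemma 2.5 setting). [folklore] -/
theorem locAtCentre_le {B : Subring K} {O : ValuationSubring K} (h : B ≤ O.toSubring) :
    locAtCentre B O ≤ O.toSubring := by
  rintro _ ⟨y, hy, z, hz, hv, rfl⟩
  change y / z ∈ O
  rw [← O.valuation_le_one_iff, map_div₀, hv, div_one, O.valuation_le_one_iff]
  exact h hy

/-- Monotonicity: `B₁ ⊆ B₂ ⇒ (B₁)_{𝔪 ∩ B₁} ⊆ (B₂)_{𝔪 ∩ B₂}` (NSp Lemma 2.5 (1)).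
[cite: NovacoskiSpivakovsky2014, Lemma 2.5 (1)] -/
theorem locAtCentre_mono {B₁ B₂ : Subring K} (O : ValuationSubring K) (h : B₁ ≤ B₂) :
    locAtCentre B₁ O ≤ locAtCentre B₂ O := by
  rintro _ ⟨y, hy, z, hz, hv, rfl⟩
  exact ⟨y, h hy, z, h hz, hv, rfl⟩

/-- An element of `B_{𝔪_O ∩ B}` of value `1` has its inverse in `B_{𝔪_O ∩ B}`. [folklore] -/
theorem inv_mem_locAtCentre {B : Subring K} {O : ValuationSubring K}
    {x : K} (hx : x ∈ locAtCentre B O) (hv : O.valuation x = 1) : x⁻¹ ∈ locAtCentre B O := by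
  obtain ⟨y, hy, z, hz, hvz, rfl⟩ := hx
  have hvy : O.valuation y = 1 := by
    rw [map_div₀, hvz, div_one] at hv
    exact hv
  exact ⟨z, hz, y, hy, hvy, by rw [inv_div]⟩

/-- Idempotence: localising `B_{𝔪_O ∩ B}` at its own centre changes nothing (`B ⊆ O`).
[cite: NovacoskiSpivakovsky2014, Lemma 2.5 (2)] -/
theorem locAtCentre_locAtCentre (B : Subring K) (O : ValuationSubring K) :
    locAtCentre (locAtCentre B O) O = locAtCentre B O := by
  refine le_antisymm ?_ (le_locAtCentre _ O)
  rintro _ ⟨y, hy, z, hz, hv, rfl⟩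
  rw [div_eq_mul_inv]
  exact Subring.mul_mem _ hy (inv_mem_locAtCentre hz hv)

/-- In `B_{𝔪_O ∩ B}` (`B ⊆ O`) the non-units are exactly the elements of value `< 1`.
[folklore] -/
theorem not_isUnit_locAtCentre_iff {B : Subring K} {O : ValuationSubring K} (h : B ≤ O.toSubring)
    (x : locAtCentre B O) : ¬ IsUnit x ↔ O.valuation (x : K) < 1 := by
  have hle := locAtCentre_le h
  constructor
  · intro hx
    rcases (O.valuation_le_one_iff _).mpr (hle x.2) |>.lt_or_eq with hlt | heq
    · exact hlt
    · exact absurd ⟨⟨x, ⟨x⁻¹, inv_mem_locAtCentre x.2 heq⟩,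
        Subtype.ext (mul_inv_cancel₀ (ne_zero_of_valuation_eq_one heq)),
        Subtype.ext (inv_mul_cancel₀ (ne_zero_of_valuation_eq_one heq))⟩, rfl⟩ hx
  · rintro hlt ⟨u, rfl⟩
    have h1 : O.valuation ((u : locAtCentre B O) : K) * O.valuation ((↑u⁻¹ : locAtCentre B O) : K)
        = 1 := by
      rw [← map_mul, ← Subring.coe_mul, Units.mul_inv, Subring.coe_one, map_one]
    have h2 : O.valuation ((↑u⁻¹ : locAtCentre B O) : K) ≤ 1 :=
      (O.valuation_le_one_iff _).mpr (hle (↑u⁻¹ : locAtCentre B O).2)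
    have : O.valuation ((u : locAtCentre B O) : K) * O.valuation ((↑u⁻¹ : locAtCentre B O) : K)
        < 1 * 1 := mul_lt_mul_of_lt_of_le_of_nonneg_of_pos hlt h2 zero_le zero_lt_one
    rw [h1, one_mul] at this
    exact lt_irrefl _ this

/-- `B_{𝔪_O ∩ B}` (`B ⊆ O`) is a local ring: its non-units, the elements of value `< 1`, are
closed under addition. [folklore] -/
theorem isLocalRing_locAtCentre {B : Subring K} {O : ValuationSubring K} (h : B ≤ O.toSubring) :
    IsLocalRing (locAtCentre B O) := by
  haveI : Nontrivial (locAtCentre B O) := ⟨⟨0, 1, by simp⟩⟩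
  refine IsLocalRing.of_nonunits_add ?_
  intro a b ha hb
  rw [mem_nonunits_iff, not_isUnit_locAtCentre_iff h] at ha hb ⊢
  calc O.valuation ((a + b : locAtCentre B O) : K) = O.valuation ((a : K) + b) := rfl
    _ ≤ max (O.valuation (a : K)) (O.valuation (b : K)) := Valuation.map_add _ _ _
    _ < 1 := max_lt ha hb

/-- In the local ring `B_{𝔪_O ∩ B}` (`B ⊆ O`) the maximal ideal consists of the elements of
value `< 1`: it is the centre of `O`, i.e. `O` dominates `B_{𝔪_O ∩ B}`. [folklore] -/
theorem mem_maximalIdeal_locAtCentre_iff {B : Subring K} {O : ValuationSubring K}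
    (h : B ≤ O.toSubring) (x : locAtCentre B O) :
    (haveI := isLocalRing_locAtCentre h; x ∈ IsLocalRing.maximalIdeal (locAtCentre B O)) ↔
      O.valuation (x : K) < 1 := by
  haveI := isLocalRing_locAtCentre h
  rw [IsLocalRing.mem_maximalIdeal, mem_nonunits_iff, not_isUnit_locAtCentre_iff h]

/-- The maximal ideal of `B_{𝔪_O ∩ B}` is the centre of `O` on it (domination).
[cite: NovacoskiSpivakovsky2014, Def. 2.8] -/
theorem maximalIdeal_locAtCentre {B : Subring K} {O : ValuationSubring K} (h : B ≤ O.toSubring) :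
    (haveI := isLocalRing_locAtCentre h; IsLocalRing.maximalIdeal (locAtCentre B O)) =
      subringCentre (locAtCentre B O) O (locAtCentre_le h) := by
  ext x
  rw [mem_maximalIdeal_locAtCentre_iff h, mem_subringCentre_iff]

/-! ## `locAtCentre B O` is the localisation of `B` at the centre -/

/-- The `B`-algebra structure of `B_{𝔪_O ∩ B} ⊆ K` (the inclusion `B ⊆ B_{𝔪_O ∩ B}`). [folklore] -/
instance locAtCentre.algebra (B : Subring K) (O : ValuationSubring K) :
    Algebra B (locAtCentre B O) :=
  (Subring.inclusion (le_locAtCentre B O)).toAlgebra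

/-- The structure map `B → B_{𝔪_O ∩ B}` is the inclusion (in `K`). [folklore] -/
theorem locAtCentre.algebraMap_apply (B : Subring K) (O : ValuationSubring K) (x : B) :
    ((algebraMap B (locAtCentre B O) x : locAtCentre B O) : K) = x :=
  rfl

/-- `B → B_{𝔪_O ∩ B} → K` is a scalar tower (all maps are inclusions). [folklore] -/
instance locAtCentre.isScalarTower (B : Subring K) (O : ValuationSubring K) :
    IsScalarTower B (locAtCentre B O) K :=
  IsScalarTower.of_algebraMap_eq fun _ => rfl

/-- **`locAtCentre B O` is the localisation of `B` at the centre `𝔪_O ∩ B`** (`B ⊆ O`).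
[cite: NovacoskiSpivakovsky2014, Def. 2.8] -/
instance isLocalization_locAtCentre {B : Subring K} {O : ValuationSubring K}
    (h : B ≤ O.toSubring) :
    IsLocalization.AtPrime (locAtCentre B O) (subringCentre B O h) where
  map_units s := by
    have hv : O.valuation ((s : B) : K) = 1 := valuation_eq_one_of_not_mem_subringCentre h s.2
    have h0 := ne_zero_of_valuation_eq_one hv
    refine ⟨⟨algebraMap B _ (s : B), ⟨((s : B) : K)⁻¹, inv_mem_locAtCentre
      (le_locAtCentre B O (s : B).2) hv⟩, Subtype.ext ?_, Subtype.ext ?_⟩, rfl⟩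
    · change ((s : B) : K) * ((s : B) : K)⁻¹ = 1
      exact mul_inv_cancel₀ h0
    · change ((s : B) : K)⁻¹ * ((s : B) : K) = 1
      exact inv_mul_cancel₀ h0
  surj x := by
    obtain ⟨y, hy, z, hz, hv, hx⟩ := x.2
    have hzc : (⟨z, hz⟩ : B) ∉ subringCentre B O h := by
      rw [mem_subringCentre_iff]; exact fun hlt => (lt_irrefl _ (hv ▸ hlt))
    refine ⟨(⟨y, hy⟩, ⟨⟨z, hz⟩, hzc⟩), Subtype.ext ?_⟩
    change (x : K) * z = y
    rw [hx, div_mul_cancel₀ _ (ne_zero_of_valuation_eq_one hv)]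
  exists_of_eq {a b} hab := ⟨1, by
    have : ((a : B) : K) = b := congrArg (fun t : locAtCentre B O => (t : K)) hab
    simpa using Subtype.ext this⟩

/-- Hence `B_{𝔪_O ∩ B} ≅ Localization.AtPrime (𝔪_O ∩ B)` as rings. [folklore] -/
def locAtCentreEquiv {B : Subring K} {O : ValuationSubring K} (h : B ≤ O.toSubring) :
    Localization.AtPrime (subringCentre B O h) ≃ₐ[B] locAtCentre B O :=
  haveI := isLocalization_locAtCentre h
  IsLocalization.algEquiv (subringCentre B O h).primeCompl _ _

/-- Regularity of `B` at the centre of `O` can be read off `locAtCentre B O`. [folklore] -/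
theorem isRegularLocalRing_locAtCentre_iff {B : Subring K} {O : ValuationSubring K}
    (h : B ≤ O.toSubring) :
    IsRegularLocalRing (locAtCentre B O) ↔
      IsRegularLocalRing (Localization.AtPrime (subringCentre B O h)) :=
  ⟨fun _ => IsRegularLocalRing.of_ringEquiv (locAtCentreEquiv h).toRingEquiv.symm,
    fun _ => IsRegularLocalRing.of_ringEquiv (locAtCentreEquiv h).toRingEquiv⟩

/-! ## Local blowing ups -/

/-- **`B'` is a local blowing up of `B` with respect to `O`** (Novacoski–Spivakovsky 2014,
Def. 2.8: `R' = R[a₁/b₁, …, a_r/b_r]` with `ν(bᵢ) ≤ ν(aᵢ)`, i.e. finitely many new elements of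
non-negative value, followed by localisation at the centre `m_ν ∩ R'`): `B ⊆ O` and
`B' = (B[t])_{𝔪_O ∩ B[t]}` inside `K` for a finite `t ⊆ O`. (For `K = Frac B` every element
of `O` is a quotient `a/b` of elements of `B` with `ν(b) ≤ ν(a)`, so this is the printed
notion; for general `B ⊆ K` it is the natural extension.)
[cite: NovacoskiSpivakovsky2014, Def. 2.8] -/
def IsLocalBlowup (O : ValuationSubring K) (B B' : Subring K) : Prop :=
  B ≤ O.toSubring ∧ ∃ t : Finset K, (↑t : Set K) ⊆ O ∧
    B' = locAtCentre (Subring.closure ((B : Set K) ∪ ↑t)) O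

/-- **`B'` is the local blowing up of `B` along the ideal `I` with respect to `O`**
(Novacoski–Spivakovsky 2014, Def. 2.11; Cossart–Piltant 2019, §2.2): `B ⊆ O`, `I` is
generated by a finite set `u` containing an element `u₀ ≠ 0` of minimal value
(`ν(u₀) ≤ ν(x)` for `x ∈ u`, i.e. `O.valuation x ≤ O.valuation u₀`), and
`B' = (B[u/u₀])_{𝔪_O ∩ B[u/u₀]}` — the local ring at the centre of `O` of the `u₀`-chart of the
blowing up of `Spec B` along `I`. (NSp show after Lemma 2.10 that `B'` depends only on `I`.)
[cite: NovacoskiSpivakovsky2014, Def. 2.11] -/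
def IsLocalBlowupAlong (O : ValuationSubring K) (B : Subring K) (I : Ideal B) (B' : Subring K) :
    Prop :=
  B ≤ O.toSubring ∧ ∃ (u : Finset B) (u₀ : B), Ideal.span (↑u : Set B) = I ∧ u₀ ∈ u ∧ u₀ ≠ 0 ∧
    (∀ x ∈ u, O.valuation (x : K) ≤ O.valuation (u₀ : K)) ∧
    B' = locAtCentre (Subring.closure ((B : Set K) ∪ (fun x : B => (x : K) / u₀) '' ↑u)) O

/-- A local blowing up along an ideal is a local blowing up (the new generators `x/u₀` have
non-negative value). [cite: NovacoskiSpivakovsky2014, Def. 2.11] -/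
theorem IsLocalBlowupAlong.isLocalBlowup {O : ValuationSubring K} {B : Subring K} {I : Ideal B}
    {B' : Subring K} (H : IsLocalBlowupAlong O B I B') : IsLocalBlowup O B B' := by
  classical
  obtain ⟨hB, u, u₀, -, -, hu₀, hval, rfl⟩ := H
  refine ⟨hB, u.image fun x : B => (x : K) / u₀, ?_, by rw [Finset.coe_image]⟩
  intro y hy
  rw [Finset.coe_image] at hy
  obtain ⟨x, hx, rfl⟩ := hy
  have h0 : ((u₀ : B) : K) ≠ 0 := fun e => hu₀ (Subtype.ext e)
  have hv0 : O.valuation ((u₀ : B) : K) ≠ 0 := by simpa using h0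
  change (x : K) / u₀ ∈ O
  rw [← O.valuation_le_one_iff, map_div₀, div_le_one₀ (pos_iff_ne_zero.mpr hv0)]
  exact hval x hx

namespace IsLocalBlowup

variable {O : ValuationSubring K} {B B' B'' : Subring K}

/-- The source of a local blowing up lies in `O`. [folklore] -/
theorem source_le (H : IsLocalBlowup O B B') : B ≤ O.toSubring := H.1

/-- A local blowing up dominates the source: `B ⊆ B'`. [folklore] -/
theorem le (H : IsLocalBlowup O B B') : B ≤ B' := by
  obtain ⟨-, t, -, rfl⟩ := H
  exact (Subring.subset_closure.trans' Set.subset_union_left).trans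
    (le_locAtCentre _ O)

/-- A local blowing up lies in `O` (the new elements have non-negative value).
[cite: NovacoskiSpivakovsky2014, Def. 2.8] -/
theorem target_le (H : IsLocalBlowup O B B') : B' ≤ O.toSubring := by
  obtain ⟨hB, t, ht, rfl⟩ := H
  exact locAtCentre_le (Subring.closure_le.mpr (Set.union_subset hB ht))

/-- The target of a local blowing up is a local ring dominated by `O`. [folklore] -/
theorem isLocalRing (H : IsLocalBlowup O B B') : IsLocalRing B' := by
  obtain ⟨hB, t, ht, rfl⟩ := H
  exact isLocalRing_locAtCentre (Subring.closure_le.mpr (Set.union_subset hB ht))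

/-- The target of a local blowing up is its own localisation at the centre. [folklore] -/
theorem locAtCentre_eq (H : IsLocalBlowup O B B') : locAtCentre B' O = B' := by
  obtain ⟨hB, t, ht, rfl⟩ := H
  exact locAtCentre_locAtCentre _ O

/-- The trivial local blowing up: `B ↦ B_{𝔪_O ∩ B}` (`t = ∅`). [folklore] -/
theorem locAtCentre_self (hB : B ≤ O.toSubring) : IsLocalBlowup O B (locAtCentre B O) :=
  ⟨hB, ∅, by simp, by simp [Subring.closure_eq]⟩

/-- **Local blowing ups compose** (Novacoski–Spivakovsky, proof of Lemma 2.9 run backwards: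
`((B[t])_{𝔪}[t'])_{𝔪} = (B[t ∪ t'])_{𝔪}` inside `K`).
[cite: NovacoskiSpivakovsky2014, Lemma 2.9] -/
theorem trans (H₁ : IsLocalBlowup O B B') (H₂ : IsLocalBlowup O B' B'') :
    IsLocalBlowup O B B'' := by
  classical
  obtain ⟨hB, t₁, ht₁, rfl⟩ := H₁
  obtain ⟨-, t₂, ht₂, rfl⟩ := H₂
  have hB' : (B : Set K) ⊆ O := hB
  have hC₁O : Subring.closure ((B : Set K) ∪ ↑t₁) ≤ O.toSubring :=
    Subring.closure_le.mpr (Set.union_subset hB' ht₁)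
  have hCO : Subring.closure ((B : Set K) ∪ ↑(t₁ ∪ t₂)) ≤ O.toSubring := by
    rw [Finset.coe_union]
    exact Subring.closure_le.mpr (Set.union_subset hB' (Set.union_subset ht₁ ht₂))
  have hC₁C : Subring.closure ((B : Set K) ∪ ↑t₁) ≤
      Subring.closure ((B : Set K) ∪ ↑(t₁ ∪ t₂)) := by
    rw [Finset.coe_union]
    exact Subring.closure_mono (Set.union_subset_union_right _ Set.subset_union_left)
  refine ⟨hB, t₁ ∪ t₂, by rw [Finset.coe_union]; exact Set.union_subset ht₁ ht₂,
    le_antisymm ?_ ?_⟩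
  · -- `((C₁)_𝔪[t₂])_𝔪 ⊆ C_𝔪`: `(C₁)_𝔪[t₂] ⊆ C_𝔪`, then localise and use idempotence
    have h1 : Subring.closure
        ((locAtCentre (Subring.closure ((B : Set K) ∪ ↑t₁)) O : Set K) ∪ ↑t₂) ≤
        locAtCentre (Subring.closure ((B : Set K) ∪ ↑(t₁ ∪ t₂))) O := by
      refine Subring.closure_le.mpr (Set.union_subset (locAtCentre_mono O hC₁C) ?_)
      intro x hx
      refine le_locAtCentre _ O (Subring.subset_closure (Or.inr ?_))
      rw [Finset.coe_union]
      exact Or.inr hx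
    exact (locAtCentre_mono O h1).trans (locAtCentre_locAtCentre _ O).le
  · -- `C ⊆ (C₁)_𝔪[t₂]`
    refine locAtCentre_mono O (Subring.closure_le.mpr ?_)
    rintro x (hx | hx)
    · exact Subring.subset_closure (Or.inl (le_locAtCentre _ O (Subring.subset_closure (Or.inl hx))))
    · rw [Finset.coe_union] at hx
      rcases hx with hx | hx
      · exact Subring.subset_closure
          (Or.inl (le_locAtCentre _ O (Subring.subset_closure (Or.inr hx))))
      · exact Subring.subset_closure (Or.inr hx)

end IsLocalBlowup

/-! ## Towers of local blowing ups and local uniformization -/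

/-- **A tower of local blowing ups is a single local blowing up, or trivial**: if
`B = B₀ → B₁ → ⋯ → B_n = B'` are local blowing ups with respect to `O` then
`locAtCentre B' O = (B[t])_{𝔪_O ∩ B[t]}` for some finite `t ⊆ O` (for `n ≥ 1` the left side is
`B'` itself). [cite: NovacoskiSpivakovsky2014, Lemma 2.9] -/
theorem exists_eq_locAtCentre_of_reflTransGen {O : ValuationSubring K} {B B' : Subring K}
    (hB : B ≤ O.toSubring) (H : Relation.ReflTransGen (IsLocalBlowup O) B B') :
    B' ≤ O.toSubring ∧ ∃ t : Finset K, (↑t : Set K) ⊆ O ∧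
      locAtCentre B' O = locAtCentre (Subring.closure ((B : Set K) ∪ ↑t)) O := by
  have key : B' = B ∨ IsLocalBlowup O B B' := by
    induction H with
    | refl => exact Or.inl rfl
    | tail _ h ih =>
      rcases ih with rfl | ih
      · exact Or.inr h
      · exact Or.inr (ih.trans h)
  rcases key with rfl | h
  · exact ⟨hB, ∅, by simp, by simp [Subring.closure_eq]⟩
  · obtain ⟨-, t, ht, rfl⟩ := id h
    exact ⟨h.target_le, t, ht, h.locAtCentre_eq⟩

/-- A tower of local blowing ups of positive length is one local blowing up.
[cite: NovacoskiSpivakovsky2014, Lemma 2.9] -/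
theorem isLocalBlowup_of_transGen {O : ValuationSubring K} {B B' : Subring K}
    (H : Relation.TransGen (IsLocalBlowup O) B B') : IsLocalBlowup O B B' := by
  induction H with
  | single h => exact h
  | tail _ h ih => exact ih.trans h

/-- **Local uniformization by local blowing ups gives the finitely-generated-model form.**
If a tower of local blowing ups of `B ⊆ O` with respect to `O` ends with a regular local ring
`B'` (Novacoski–Spivakovsky, Def. 2.20: "`ν` admits local uniformization"), then there is a
finite `t ⊆ O` such that `B[t] ⊆ O` and `B[t]` localised at the centre `𝔪_O ∩ B[t]` is a
regular local ring — the shape of the conclusions of `RelLocalUniformization`,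
`LocalUniformization3`, `CPLocalUniformization` in this topic.
[cite: NovacoskiSpivakovsky2014, Def. 2.20 and Lemma 2.9] -/
theorem exists_fg_regular_of_tower {O : ValuationSubring K} {B B' : Subring K}
    (hB : B ≤ O.toSubring) (H : Relation.ReflTransGen (IsLocalBlowup O) B B')
    (hloc : locAtCentre B' O = B') (hreg : IsRegularLocalRing B') :
    ∃ (t : Finset K) (h : Subring.closure ((B : Set K) ∪ ↑t) ≤ O.toSubring),
      IsRegularLocalRing (Localization.AtPrime (subringCentre (Subring.closure ((B : Set K) ∪ ↑t)) O h)) := by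
  obtain ⟨-, t, ht, he⟩ := exists_eq_locAtCentre_of_reflTransGen hB H
  have hC : Subring.closure ((B : Set K) ∪ ↑t) ≤ O.toSubring :=
    Subring.closure_le.mpr (Set.union_subset hB ht)
  refine ⟨t, hC, (isRegularLocalRing_locAtCentre_iff hC).mp ?_⟩
  rw [← he, hloc]
  exact hreg

/-- Conversely, **a finitely generated `B ⊆ B[t] ⊆ O` regular at the centre is a one-step
tower** ending with the regular local ring `(B[t])_{𝔪_O ∩ B[t]}`.
[cite: NovacoskiSpivakovsky2014, Def. 2.8 and Def. 2.20] -/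
theorem tower_of_exists_fg_regular {O : ValuationSubring K} {B : Subring K}
    (hB : B ≤ O.toSubring) {t : Finset K} (h : Subring.closure ((B : Set K) ∪ ↑t) ≤ O.toSubring)
    (hreg : IsRegularLocalRing
      (Localization.AtPrime (subringCentre (Subring.closure ((B : Set K) ∪ ↑t)) O h))) :
    ∃ B' : Subring K, Relation.ReflTransGen (IsLocalBlowup O) B B' ∧
      locAtCentre B' O = B' ∧ IsRegularLocalRing B' := by
  have ht : (↑t : Set K) ⊆ O := (Set.subset_union_right.trans Subring.subset_closure).trans h
  refine ⟨locAtCentre (Subring.closure ((B : Set K) ∪ ↑t)) O,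
    Relation.ReflTransGen.single ⟨hB, t, ht, rfl⟩, locAtCentre_locAtCentre _ O,
    (isRegularLocalRing_locAtCentre_iff h).mpr hreg⟩

/-- **The two forms of local uniformization agree.** For a subring `B ⊆ O` of `K`:
some tower of local blowing ups with respect to `O` starting at `B` ends with a regular local
ring (Novacoski–Spivakovsky 2014, Def. 2.20; Cossart–Piltant 2019, the form of the conclusion of
Thm. 1.5) iff some finitely generated `B[t] ⊆ O` is regular at the centre of `O` (the form
used by `RelLocalUniformization`/`CPLocalUniformization`). (`locAtCentre B' O = B'` records
that the members of a tower are local rings at the centre; it holds automatically after the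
first step, `IsLocalBlowup.locAtCentre_eq`.)
[cite: NovacoskiSpivakovsky2014, Def. 2.20, Lemma 2.9] -/
theorem lu_tower_iff_fg {O : ValuationSubring K} {B : Subring K} (hB : B ≤ O.toSubring) :
    (∃ B' : Subring K, Relation.ReflTransGen (IsLocalBlowup O) B B' ∧
      locAtCentre B' O = B' ∧ IsRegularLocalRing B') ↔
    ∃ (t : Finset K) (h : Subring.closure ((B : Set K) ∪ ↑t) ≤ O.toSubring),
      IsRegularLocalRing
        (Localization.AtPrime (subringCentre (Subring.closure ((B : Set K) ∪ ↑t)) O h)) :=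
  ⟨fun ⟨_, H, hloc, hreg⟩ => exists_fg_regular_of_tower hB H hloc hreg,
    fun ⟨_, h, hreg⟩ => tower_of_exists_fg_regular hB h hreg⟩

/-- Regularity at the centre only depends on the subring (transport along an equality of
subrings; the two membership proofs are irrelevant). [folklore] -/
theorem isRegularLocalRing_centre_congr {O : ValuationSubring K} {S₁ S₂ : Subring K}
    (e : S₁ = S₂) (h₁ : S₁ ≤ O.toSubring) (h₂ : S₂ ≤ O.toSubring) :
    IsRegularLocalRing (Localization.AtPrime (subringCentre S₁ O h₁)) ↔
      IsRegularLocalRing (Localization.AtPrime (subringCentre S₂ O h₂)) := by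
  subst e
  exact Iff.rfl

/-- **From a tower of local blowing ups to the `A[s]`-form of (LU).** For a ring `A` mapping to
`K` with image in `O`: if a tower of local blowing ups with respect to `O` starting at the
image of `A` ends with a regular local ring, then some finitely generated `A`-subalgebra
`A[s] ⊆ O` of `K` is regular at the centre `𝔪_O ∩ A[s]` — literally the conclusion shape of
`CPLocalUniformization` (`ArithmeticalThreefolds.lean`); the `Subalgebra k K` form of
`RelLocalUniformization` needs a further adjoin-to-`Subalgebra` step, done in
`LocalBlowupModels.lean` (`towerLU_iff_fgModel`). [cite: NovacoskiSpivakovsky2014, Def. 2.20 and Lemma 2.9] -/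
theorem exists_adjoin_regular_of_tower {A : Type*} [CommRing A] [Algebra A K]
    {O : ValuationSubring K} (hA : (algebraMap A K).range ≤ O.toSubring) {B' : Subring K}
    (H : Relation.ReflTransGen (IsLocalBlowup O) (algebraMap A K).range B')
    (hloc : locAtCentre B' O = B') (hreg : IsRegularLocalRing B') :
    ∃ (s : Finset K) (h : (Algebra.adjoin A (s : Set K)).toSubring ≤ O.toSubring),
      IsRegularLocalRing (Localization.AtPrime
        (Ideal.comap (Subring.inclusion h) (IsLocalRing.maximalIdeal O))) := by
  obtain ⟨t, h, hreg'⟩ := exists_fg_regular_of_tower hA H hloc hreg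
  have e : (Algebra.adjoin A (t : Set K)).toSubring =
      Subring.closure (((algebraMap A K).range : Set K) ∪ ↑t) := by
    rw [Algebra.adjoin_eq_ring_closure, RingHom.coe_range]
  have h' : (Algebra.adjoin A (t : Set K)).toSubring ≤ O.toSubring := e ▸ h
  exact ⟨t, h', (isRegularLocalRing_centre_congr e h' h).mpr hreg'⟩

/-! ## Local blowing up along an ideal: the chart of a generator of minimal value -/

/-- Among finitely many elements of `K`, not all zero, some nonzero one has maximal
`O.valuation` (i.e. minimal value `ν`): the denominator of the affine chart of the blowing up
which contains the centre of `O`. [folklore] -/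
theorem exists_max_valuation (O : ValuationSubring K) {ι : Type*} (u : Finset ι) (f : ι → K)
    (hne : ∃ i ∈ u, f i ≠ 0) :
    ∃ i₀ ∈ u, f i₀ ≠ 0 ∧ ∀ i ∈ u, O.valuation (f i) ≤ O.valuation (f i₀) := by
  classical
  obtain ⟨j, hj, hj0⟩ := hne
  obtain ⟨i₀, hi₀, hmax⟩ := u.exists_max_image (fun i => O.valuation (f i)) ⟨j, hj⟩
  refine ⟨i₀, hi₀, ?_, hmax⟩
  intro h0
  have := hmax j hj
  rw [h0, map_zero, le_zero_iff, map_eq_zero] at this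
  exact hj0 this

/-- **Existence of the local blowing up along a nonzero finitely generated ideal** of
`B ⊆ O`: pick a generator of minimal value. [cite: NovacoskiSpivakovsky2014, Def. 2.11] -/
theorem exists_isLocalBlowupAlong {O : ValuationSubring K} {B : Subring K} (hB : B ≤ O.toSubring)
    (I : Ideal B) (hI : I.FG) (hI0 : I ≠ ⊥) :
    ∃ B' : Subring K, IsLocalBlowupAlong O B I B' := by
  classical
  obtain ⟨u, hu⟩ := hI
  have hne : ∃ x ∈ u, ((x : B) : K) ≠ 0 := by
    by_contra! hcon
    apply hI0
    rw [← hu, Ideal.span_eq_bot]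
    intro x hx
    exact Subtype.ext (hcon x hx)
  obtain ⟨u₀, hu₀, h0, hmax⟩ := exists_max_valuation O u (fun x : B => (x : K)) hne
  exact ⟨_, hB, u, u₀, hu, hu₀, fun e => h0 (by rw [e]; rfl), hmax, rfl⟩

/-- The blown-up ideal becomes principal: in the target of the local blowing up along `I`,
every generator is a multiple of `u₀` (`x = (x/u₀) · u₀`), so `I B' = u₀ B'`.
[cite: NovacoskiSpivakovsky2014, Def. 2.11] -/
theorem IsLocalBlowupAlong.exists_span_singleton {O : ValuationSubring K} {B : Subring K}
    {I : Ideal B} {B' : Subring K} (H : IsLocalBlowupAlong O B I B') :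
    ∃ u₀ ∈ I, ∀ x ∈ I, ∃ y ∈ B', (x : K) = y * u₀ := by
  classical
  obtain ⟨hB, u, u₀, hu, hu₀, h0, hval, rfl⟩ := H
  have h0' : ((u₀ : B) : K) ≠ 0 := fun e => h0 (Subtype.ext e)
  refine ⟨u₀, hu ▸ Ideal.subset_span hu₀, fun x hx => ?_⟩
  set C := Subring.closure ((B : Set K) ∪ (fun x : B => (x : K) / u₀) '' ↑u) with hC
  -- the set of `x ∈ B` with `x / u₀ ∈ C` is an ideal containing `u`
  have key : ∀ x ∈ Ideal.span (↑u : Set B), (x : K) / u₀ ∈ C := by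
    intro x hx
    induction hx using Submodule.span_induction with
    | mem x hx => exact Subring.subset_closure (Or.inr ⟨x, hx, rfl⟩)
    | zero => simp
    | add x y _ _ hx hy => rw [Subring.coe_add, add_div]; exact C.add_mem hx hy
    | smul a x _ hx =>
      rw [smul_eq_mul, Subring.coe_mul, mul_div_assoc]
      exact C.mul_mem (Subring.subset_closure (Or.inl a.2)) hx
  refine ⟨(x : K) / u₀, le_locAtCentre C O (key x (hu ▸ hx)), ?_⟩
  rw [div_mul_cancel₀ _ h0']

end Literature.AlgebraicGeometry.Resolution

end
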